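/-
Copyright (c) 2026 the pub-hodgecm-mathlib formalisation cell (harness21).  Prover seat hodgecm-mathlib-LH3-p04 (g4): line LH3 (closer stub `stub_N9`), leaf v5 organ O-L1e
(X′-corners), brick **(X2) TWO-BLOCK DESCENT BOX, IN-REGULAR EDITION** (F0P3a-p02 (g21) scope flag 2026-09-02T11:46:31Z on RULING #18).
-/
import Literature.NumberTheory.Rogawski1990.ArchOrbFamGExtBoxDescent                  -- ★ p851016 (this seat): (B-desc) box edition; brings the whole one-place tool chain
import Literature.NumberTheory.Automorphic.ArchInnerFormTwoWallCentralizerBlock        -- ★ p851215 (this seat) (X2-M): `exists_continuousMulEquiv_centralizer_gprimeTorus_twoWall_explicit`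
import Literature.NumberTheory.Rogawski1990.ArchInnerFormSplitPlaceProper              -- ★ `uniformlyProper_gprimeBlock_split_of_ne_zero`, `uniformlyProper_arch_of_places` chain
import Literature.NumberTheory.Rogawski1990.ArchInnerFormSemiregularProper             -- ★ `uniformlyProper_gprimeBlock_cpt_of_ne`, `…_of_injective`, `stabilizer_single_le_centralizer_gprimeBlock_of_wall`
import Literature.NumberTheory.Rogawski1990.ArchOrbFamGExtTwoBlockBoxDescent          -- ★ p851307 (this seat): (X2) generic-corner edition, `isOpen_pi_twoWallBox`
import Literature.NumberTheory.Automorphic.ArchInnerFormChartOrbitalSmoothWalls         -- ★ (A) p850547 (F0P3a-p05): `uniformlyProper_gprimeBlock_of_inRegG_place` (in-regular places)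
import Literature.NumberTheory.Rogawski1990.ArchTransfFamilySymmetries                -- ★ `dense_regG`
import HarnessLib

/-!
# (X2) TWO-BLOCK DESCENT BOX, IN-REGULAR EDITION: the same identity around a point with nc-wall coincidences at TWO places and ARBITRARY COMPACT coincidences elsewhere
# — `chartOrbG(c) = K · ∫_{U(J) × U(J)} f(c, h₁ · P diag(e^{ic_{w₁0}}, e^{ic_{w₁2}}) P⁻¹ · h₁⁻¹, h₂ · P diag(e^{ic_{w₂0}}, e^{ic_{w₂2}}) P⁻¹ · h₂⁻¹) d(μ₀ ⊗ μ₀)`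
# (Rogawski 1990 §4.12 Lemma 4.12.1, §8.2 pp. 119–124; Harish-Chandra–van Dijk 1970 I §3; Shelstad 1979 §4)

Topic `NumberTheory/Rogawski1990`; namespace `Literature.NumberTheory.Rogawski1990`.  THEOREMS ONLY (no `def`, no instance, no notation, no axiom, no named fact, no `sorry`);
kernel lane `--kind proof --supports stmt-HodgeConjecture-24833`.  Cell `pub/hodgecm-mathlib`, crux H413 (`stmt-HodgeConjecture-24833`), F0∕P3c line LH3 (closer stub `stub_N9`),
leaf v5 organ **O-L1e «X′-CORNERS»** (RULING #18: every coincidence place one-wall, ≥ 2 places), in-house road (X1) F0P3a-p02 (g21) ∕ **(X2) = this file** ∕ (X3) F0P3a-p02 +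
F0P3a-p04; sibling of ★ p851307 `ArchOrbFamGExtTwoBlockBoxDescent` (generic corners), answering F0P3a-p02 (g21)'s scope flag: the organ O-L1e allows COMPACT coincidences
(`e^{ix_{w,i}} = e^{ix_{w,j}}` with `slotSign w i = slotSign w j`) at the non-corner places.  Author LH3-p04 (g4).

THE ONE IDEA.  ★ p851307 uses injectivity at the other places only through the BASE POINT of the centraliser `Z(γ_p)` ((X2-M): `K ≤ T′`, `K` commutative; the
Haar split), never through the CENTRE of the box: ★ D4b is pointwise in `c` and needs only `T_S ≤ Z(γ)` and Harish-Chandra's compactness at `c`.  So we descend at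
`γ_{p′}`, `p′ :=` the centre `x` at `w₁, w₂` and on `S`, a fixed REGULAR point `c₀` (★ `dense_regG`) at every other compact place, and prove the compactness binder on
an IN-REGULAR box around `x` modulo `Z(γ_{p′})` place by place: `w₁, w₂` by ★ `uniformlyProper_gprimeBlock_cpt_of_ne` (slot `1` simple), every other place by
★ (A) p850547 `uniformlyProper_gprimeBlock_of_inRegG_place` at the regular point `q := x on S, c₀ elsewhere` (`q_w = p′_w` off the corners, ★ `gprimeBlock_congr_place`);
everything else is ★ p851307 §2 verbatim at `p′`.

THE MATHEMATICS.  Same descent as ★ p851016 at the ONE group element `γ_p = gprimeTorus α S p`, now with walls `e^{ip_{w,0}} = e^{ip_{w,2}} ≠ e^{ip_{w,1}}` at TWO covered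
places `w₁ ≠ w₂ ∉ S` (regular elsewhere, `x_w ≠ 0` on `S`): §1 Harish-Chandra's compactness ★ D4b-1 on a compact BOX around `p` — assembled PLACE BY PLACE exactly as ★ p850367
`uniformlyProper_gprimeTorus_of_semireg` (★ `uniformlyProper_arch_of_places`: the two wall places by ★ `uniformlyProper_gprimeBlock_cpt_of_ne` + ★
`stabilizer_single_le_centralizer_gprimeBlock_of_wall`, the other compact places by ★ `…_of_injective`, the split places by ★ `uniformlyProper_gprimeBlock_split_of_ne_zero`);
§2 the (X2-M) splitting ★ p851215 `Z(γ_p) ≃ₜ* (B₁ × B₂) × K` standardised blockwise to `U(J) × U(J)` (★ (B-STD) `exists_continuousMulEquiv_prod_std` at `w₁` and at `w₂`),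
the block torus `A = φ₁(A₁) × φ₂(A₂)` (compact, commutative), `Ψ : Z(γ_p) ⧸ T′ ≃ₜ (U(J) × U(J)) ⧸ A` (★ `exists_quotient_homeomorph_of_map_eq_prod_top`), the descent scalar `κ` against
the PRODUCT Haar measure `μ₀ ⊗ μ₀` (★ `exists_smul_map_mk_of_block_compact`), ONE cut-off `β`, and the smooth ambient reading
`f(c, X, Y) = χ(X, Y) · ΘM(Λ₁(M₁⁻¹ X M₁) · Λ₂(M₂⁻¹ Y M₂) · ↑↑γ_S(update (update c w₁ (0,c_{w₁1},0)) w₂ (0,c_{w₂1},0)))` (★ (aM-SMOOTH), ★ (eM-SMOOTH) at both places, clauses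
[8]₁ [8]₂ [10] of (X2-M), the frame matrices `M_i` of `φ_i`).  ★ D4b and ★ p850417 §1 `integral_descConj_eq_smul_integral_of_block` (generic block group) give
  **`chartOrbG L α ν′ S a′ c = (dt′(B′)·κ) · ∫_{U(J) × U(J)} f(c, ↑↑(q₁ · P t_{c,w₁} P⁻¹ · q₁⁻¹), ↑↑(q₂ · P t_{c,w₂} P⁻¹ · q₂⁻¹)) d(μ₀ ⊗ μ₀)(q)`  for all `c ∈ U ∩ RegG S`**,
`f` jointly `C^∞`, compactly supported in `(X, Y)` uniformly in `c`, depending on `c` only through the double tangential point.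
HONEST LABEL: HC_CM is proved only modulo the 7 printed citations (2 remaining: hLiu418 = `stmt-HodgeConjecture-24832`, h413 = `stmt-HodgeConjecture-24833`) until rung 0 closes;
count-neutral assembly of ★ bricks.

## References
* [Rogawski1990] J. D. Rogawski, *Automorphic Representations of Unitary Groups in Three Variables*, Ann. of Math. Stud. 123 (1990), §4.12 Lemma 4.12.1 p. 66, §8.2 pp. 119–124.
* [HarishChandra1970] Harish-Chandra (notes by G. van Dijk), *Harmonic Analysis on Reductive p-adic Groups*, LNM 162 (1970), Part I §3 Lemmas 22–23.
* [Shelstad1979] D. Shelstad, *Characters and inner forms of a quasi-split group over ℝ*, Compositio Math. 39 (1979), §4 pp. 22–25.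
* [Folland1995] G. B. Folland, *A Course in Abstract Harmonic Analysis* (1995), §2.6 Thm. 2.49, (2.52).
-/

set_option autoImplicit false

noncomputable section

open MeasureTheory MeasureTheory.Measure NumberField NumberField.InfinitePlace NumberField.mixedEmbedding Matrix Complex Set Filter Topology
open scoped MatrixGroups Matrix Real Classical ENNReal NNReal ContDiff Matrix.Norms.Operator Pointwise
open Literature.NumberTheory.Automorphic Literature.NumberTheory.Automorphic.UnitaryGroup Literature.NumberTheory.Automorphic.ArchCartan
open Literature.NumberTheory.GaloisRepresentations Literature.MeasureTheory.Group

namespace Literature.NumberTheory.Rogawski1990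

/-! ## §1 Harish-Chandra's compactness on an IN-REGULAR box around the centre, modulo the centraliser at the regularised base point -/

section Box

variable (L : Type) [Field L] [NumberField L] [IsCMField L] (α : Fin 3 → L)
  (S : Finset {w : InfinitePlace L // IsComplex w}) (w₁ w₂ : {w : InfinitePlace L // IsComplex w})

omit [IsCMField L] in
/-- The in-regular two-wall box is OPEN: slot `1` simple at `w₁`, `w₂`; at the other compact places only the NONCOMPACT coincidences (different slot signs) are excluded;
`x_w ≠ 0` at the split places. [cite: Rogawski1990, §8.2 p. 118] [cite: Shelstad1979, §4 p. 22] -/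
theorem isOpen_pi_twoWallInRegBox :
    IsOpen (Set.pi Set.univ (fun w : {w : InfinitePlace L // IsComplex w} => {cw : Fin 3 → ℝ |
        ((w = w₁ ∨ w = w₂) → ∀ j : Fin 3, j ≠ 1 → Circle.exp (cw 1) ≠ Circle.exp (cw j)) ∧
        (w ≠ w₁ → w ≠ w₂ → (w ∈ S → cw 0 ≠ 0) ∧
          (w ∉ S → ∀ i j : Fin 3, i ≠ j → slotSign L α w i ≠ slotSign L α w j → Circle.exp (cw i) ≠ Circle.exp (cw j)))})) := by
  have himp : ∀ (P : Prop) (Q : (Fin 3 → ℝ) → Prop), IsOpen {cw | Q cw} → IsOpen {cw | P → Q cw} := fun P Q hQ => by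
    by_cases hP : P
    · have h : {cw : Fin 3 → ℝ | P → Q cw} = {cw | Q cw} := Set.ext fun cw => ⟨fun h => h hP, fun h _ => h⟩
      rw [h]; exact hQ
    · have h : {cw : Fin 3 → ℝ | P → Q cw} = Set.univ := Set.eq_univ_of_forall fun cw h => absurd h hP
      rw [h]; exact isOpen_univ
  have hwall : IsOpen {cw : Fin 3 → ℝ | ∀ j : Fin 3, j ≠ 1 → Circle.exp (cw 1) ≠ Circle.exp (cw j)} := by
    have h : {cw : Fin 3 → ℝ | ∀ j : Fin 3, j ≠ 1 → Circle.exp (cw 1) ≠ Circle.exp (cw j)} = ⋂ j : Fin 3, {cw | j ≠ 1 → Circle.exp (cw 1) ≠ Circle.exp (cw j)} := by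
      ext cw; simp only [Set.mem_setOf_eq, Set.mem_iInter]
    rw [h]
    exact isOpen_iInter_of_finite fun j => himp _ _ (isOpen_ne_fun (Circle.exp.continuous.comp (continuous_apply 1)) (Circle.exp.continuous.comp (continuous_apply j)))
  have hin : ∀ w : {w : InfinitePlace L // IsComplex w}, IsOpen {cw : Fin 3 → ℝ | ∀ i j : Fin 3, i ≠ j → slotSign L α w i ≠ slotSign L α w j → Circle.exp (cw i) ≠ Circle.exp (cw j)} := by
    intro w
    have h : {cw : Fin 3 → ℝ | ∀ i j : Fin 3, i ≠ j → slotSign L α w i ≠ slotSign L α w j → Circle.exp (cw i) ≠ Circle.exp (cw j)} =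
        ⋂ i : Fin 3, ⋂ j : Fin 3, {cw | i ≠ j → slotSign L α w i ≠ slotSign L α w j → Circle.exp (cw i) ≠ Circle.exp (cw j)} := by
      ext cw; simp only [Set.mem_setOf_eq, Set.mem_iInter]
    rw [h]
    exact isOpen_iInter_of_finite fun i => isOpen_iInter_of_finite fun j =>
      himp _ _ (himp _ _ (isOpen_ne_fun (Circle.exp.continuous.comp (continuous_apply i)) (Circle.exp.continuous.comp (continuous_apply j))))
  refine isOpen_set_pi Set.finite_univ fun w _ => ?_
  exact (himp _ _ hwall).and (himp _ _ (himp _ _ ((himp _ _ (isOpen_ne_fun (continuous_apply 0) continuous_const)).and (himp _ _ (hin w)))))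

variable (p' q : {w : InfinitePlace L // IsComplex w} → Fin 3 → ℝ)

/-- **★ D4b-1 around an IN-REGULAR two-wall point, modulo the centraliser at the regularised base point `p′`**: `p′` has walls with simple slot `1` at `w₁, w₂`; `q ∈ RegG S`
agrees with `p′` off `{w₁, w₂}`; uniform properness modulo `Z(γ_{p′})` for chart points in a compact subset of the in-regular box (compact coincidences at the other places
allowed). [cite: Rogawski1990, §4.12 Lemma 4.12.1 p. 66; §8.2 p. 122] [cite: HarishChandra1970, Part I §3 Lemma 22] -/
theorem uniformlyProper_gprimeTorus_of_twoWall_inReg (hα : ∀ i, α i ≠ 0)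
    (hreal : ∀ (w : {w : InfinitePlace L // IsComplex w}) (i : Fin 3), (w.1.embedding (α i)).im = 0) (hS : ∀ w, w ∈ S → w ∈ splitChartPlaces L α)
    (hw₁ : w₁ ∉ S) (hw₂ : w₂ ∉ S)
    (hwall₁ : ∀ j j' : Fin 3, j ≠ 1 → j' ≠ 1 → Circle.exp (p' w₁ j) = Circle.exp (p' w₁ j'))
    (hwall₂ : ∀ j j' : Fin 3, j ≠ 1 → j' ≠ 1 → Circle.exp (p' w₂ j) = Circle.exp (p' w₂ j'))
    (hq : q ∈ RegG S) (hqp : ∀ w, w ≠ w₁ → w ≠ w₂ → q w = p' w)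
    (B : {w : InfinitePlace L // IsComplex w} → Set (Fin 3 → ℝ))
    (hB₁ : B w₁ ⊆ {cw : Fin 3 → ℝ | ∀ j, j ≠ 1 → Circle.exp (cw 1) ≠ Circle.exp (cw j)})
    (hB₂ : B w₂ ⊆ {cw : Fin 3 → ℝ | ∀ j, j ≠ 1 → Circle.exp (cw 1) ≠ Circle.exp (cw j)})
    (hBin : ∀ w, w ≠ w₁ → w ≠ w₂ → B w ⊆ {cw : Fin 3 → ℝ | (w ∈ S → cw 0 ≠ 0) ∧
      (w ∉ S → ∀ i j : Fin 3, i ≠ j → slotSign L α w i ≠ slotSign L α w j → Circle.exp (cw i) ≠ Circle.exp (cw j))}) :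
    ∀ K ⊆ Set.pi Set.univ B, IsCompact K → ∀ C' : Set ↥(arch (↥(maximalRealSubfield L)) L (IsCMField.complexConj L) 3 (Matrix.diagonal α)), IsCompact C' →
      ∃ 𝒦' : Set (↥(arch (↥(maximalRealSubfield L)) L (IsCMField.complexConj L) 3 (Matrix.diagonal α)) ⧸ Subgroup.centralizer ({gprimeTorus L α S p'} : Set ↥(arch (↥(maximalRealSubfield L)) L (IsCMField.complexConj L) 3 (Matrix.diagonal α)))),
        IsCompact 𝒦' ∧ ∀ c ∈ K, ∀ y' : ↥(arch (↥(maximalRealSubfield L)) L (IsCMField.complexConj L) 3 (Matrix.diagonal α)), y' * gprimeTorus L α S c * y'⁻¹ ∈ C' →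
          (QuotientGroup.mk y' : ↥(arch (↥(maximalRealSubfield L)) L (IsCMField.complexConj L) 3 (Matrix.diagonal α)) ⧸ Subgroup.centralizer ({gprimeTorus L α S p'} : Set ↥(arch (↥(maximalRealSubfield L)) L (IsCMField.complexConj L) 3 (Matrix.diagonal α)))) ∈ 𝒦' := by
  have hMM' : ∀ g : ∀ w : {w : InfinitePlace L // IsComplex w}, ↥(archLocal L 3 (Matrix.diagonal α) w),
      (archPiEquivCM 3 L (Matrix.diagonal α)).symm g ∈ Subgroup.centralizer ({gprimeTorus L α S p'} : Set ↥(arch (↥(maximalRealSubfield L)) L (IsCMField.complexConj L) 3 (Matrix.diagonal α))) ↔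
        g ∈ Subgroup.pi Set.univ fun w => Subgroup.centralizer ({gprimeBlock L α w S p'} : Set ↥(archLocal L 3 (Matrix.diagonal α) w)) :=
    fun g => by
      rw [gprimeTorus, show ((archPiEquivCM 3 L (Matrix.diagonal α)).symm g) = (archPiEquivCM 3 L (Matrix.diagonal α)).symm.toMulEquiv g from rfl,
        show ((archPiEquivCM 3 L (Matrix.diagonal α)).symm fun w => gprimeBlock L α w S p') =
          (archPiEquivCM 3 L (Matrix.diagonal α)).symm.toMulEquiv (fun w => gprimeBlock L α w S p') from rfl,
        mulEquiv_apply_mem_centralizer_singleton_iff, Subgroup.mem_centralizer_singleton_iff, Subgroup.mem_pi]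
      simp only [Set.mem_univ, true_imp_iff, Subgroup.mem_centralizer_singleton_iff]
      exact ⟨fun h w => congrFun h w, fun h => funext h⟩
  have hw₁' : ¬ (w₁ ∈ S ∧ w₁ ∈ splitChartPlaces L α) := fun h => hw₁ h.1
  have hw₂' : ¬ (w₂ ∈ S ∧ w₂ ∈ splitChartPlaces L α) := fun h => hw₂ h.1
  have hprop : ∀ w : {w : InfinitePlace L // IsComplex w}, ∀ K ⊆ B w, IsCompact K → ∀ C : Set ↥(archLocal L 3 (Matrix.diagonal α) w), IsCompact C →
      ∃ 𝒦 : Set (↥(archLocal L 3 (Matrix.diagonal α) w) ⧸ Subgroup.centralizer ({gprimeBlock L α w S p'} : Set ↥(archLocal L 3 (Matrix.diagonal α) w))),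
        IsCompact 𝒦 ∧ ∀ cw ∈ K, ∀ y : ↥(archLocal L 3 (Matrix.diagonal α) w), y * gprimeBlock L α w S (fun _ => cw) * y⁻¹ ∈ C →
          (QuotientGroup.mk y : ↥(archLocal L 3 (Matrix.diagonal α) w) ⧸ Subgroup.centralizer ({gprimeBlock L α w S p'} : Set ↥(archLocal L 3 (Matrix.diagonal α) w))) ∈ 𝒦 := by
    intro w
    by_cases hw1 : w = w₁
    · subst hw1
      exact uniformlyProper_mono _ _ hB₁ (uniformlyProper_gprimeBlock_cpt_of_ne L α S hα (hreal w) hw₁' 1 _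
        (stabilizer_single_le_centralizer_gprimeBlock_of_wall L α S hα (hreal w) hw₁' 1 p' hwall₁))
    · by_cases hw2 : w = w₂
      · subst hw2
        exact uniformlyProper_mono _ _ hB₂ (uniformlyProper_gprimeBlock_cpt_of_ne L α S hα (hreal w) hw₂' 1 _
          (stabilizer_single_le_centralizer_gprimeBlock_of_wall L α S hα (hreal w) hw₂' 1 p' hwall₂))
      · have h := uniformlyProper_gprimeBlock_of_inRegG_place L α S hα hreal hS hq w
        rw [gprimeBlock_congr_place L α S w (hqp w hw1 hw2)] at h
        exact uniformlyProper_mono _ _ (hBin w hw1 hw2) h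
  exact uniformlyProper_arch_of_places L 3 (Matrix.diagonal α) (fun w => Subgroup.centralizer ({gprimeBlock L α w S p'} : Set ↥(archLocal L 3 (Matrix.diagonal α) w)))
    (Subgroup.centralizer ({gprimeTorus L α S p'} : Set _)) hMM' (fun w cw => gprimeBlock L α w S (fun _ => cw)) B hprop

variable (x : {w : InfinitePlace L // IsComplex w} → Fin 3 → ℝ)

/-- **ONE COMPACT `C″` FOR ALL CHART POINTS NEAR AN IN-REGULAR TWO-WALL CENTRE `x`, modulo `Z(γ_{p′})`** (`p′` the regularised base point: `p′ = x` at `w₁, w₂`, regular elsewhere,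
`q ∈ RegG S` with `q = p′` off the corners): a compact `C″` and an open `U ∋ x` with `y′ · gprimeTorus c · y′⁻¹ ∈ C′ ⇒ y′ ∈ C″ · Z(gprimeTorus p′)` for every `c ∈ U`.
[cite: Rogawski1990, §4.12 Lemma 4.12.1 p. 66; §8.2 p. 122] [cite: HarishChandra1970, Part I §3 Lemma 22] [cite: Shelstad1979, §4 pp. 22–25] -/
theorem exists_isCompact_mul_centralizer_inRegBox_twoWall (hα : ∀ i, α i ≠ 0)
    (hreal : ∀ (w : {w : InfinitePlace L // IsComplex w}) (i : Fin 3), (w.1.embedding (α i)).im = 0)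
    (hS : ∀ w, w ∈ S → w ∈ splitChartPlaces L α) (hw₁ : w₁ ∉ S) (hw₂ : w₂ ∉ S)
    (hx₁ : p' w₁ = x w₁) (hx₂ : p' w₂ = x w₂)
    (h02₁ : x w₁ 0 = x w₁ 2) (h01₁ : Circle.exp (x w₁ 0) ≠ Circle.exp (x w₁ 1))
    (h02₂ : x w₂ 0 = x w₂ 2) (h01₂ : Circle.exp (x w₂ 0) ≠ Circle.exp (x w₂ 1))
    (hinreg : ∀ w, w ∉ S → w ≠ w₁ → w ≠ w₂ → ∀ i j : Fin 3, i ≠ j → slotSign L α w i ≠ slotSign L α w j → Circle.exp (x w i) ≠ Circle.exp (x w j))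
    (hxS : ∀ w, w ∈ S → x w 0 ≠ 0)
    (hq : q ∈ RegG S) (hqp : ∀ w, w ≠ w₁ → w ≠ w₂ → q w = p' w)
    {C' : Set ↥(arch (↥(maximalRealSubfield L)) L (IsCMField.complexConj L) 3 (Matrix.diagonal α))} (hC' : IsCompact C') :
    ∃ (C'' : Set ↥(arch (↥(maximalRealSubfield L)) L (IsCMField.complexConj L) 3 (Matrix.diagonal α))) (U : Set ({w : InfinitePlace L // IsComplex w} → Fin 3 → ℝ)),
      IsCompact C'' ∧ IsOpen U ∧ x ∈ U ∧
      ∀ c ∈ U, ∀ y' : ↥(arch (↥(maximalRealSubfield L)) L (IsCMField.complexConj L) 3 (Matrix.diagonal α)), y' * gprimeTorus L α S c * y'⁻¹ ∈ C' → y' ∈ C'' * ((Subgroup.centralizer ({gprimeTorus L α S p'} : Set ↥(arch (↥(maximalRealSubfield L)) L (IsCMField.complexConj L) 3 (Matrix.diagonal α)))) : Set ↥(arch (↥(maximalRealSubfield L)) L (IsCMField.complexConj L) 3 (Matrix.diagonal α))) := by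
  have hkey : ∀ (w : {w : InfinitePlace L // IsComplex w}), x w 0 = x w 2 → ∀ j : Fin 3, j ≠ 1 → Circle.exp (x w j) = Circle.exp (x w 0) := by
    intro w h j hj
    fin_cases j
    · rfl
    · exact absurd rfl hj
    · exact congrArg Circle.exp h.symm
  have hwall : ∀ (w : {w : InfinitePlace L // IsComplex w}), x w 0 = x w 2 → ∀ j j' : Fin 3, j ≠ 1 → j' ≠ 1 → Circle.exp (x w j) = Circle.exp (x w j') :=
    fun w h j j' hj hj' => (hkey w h j hj).trans (hkey w h j' hj').symm
  have hpbox : x ∈ Set.pi Set.univ (fun w : {w : InfinitePlace L // IsComplex w} => {cw : Fin 3 → ℝ |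
        ((w = w₁ ∨ w = w₂) → ∀ j : Fin 3, j ≠ 1 → Circle.exp (cw 1) ≠ Circle.exp (cw j)) ∧
        (w ≠ w₁ → w ≠ w₂ → (w ∈ S → cw 0 ≠ 0) ∧
          (w ∉ S → ∀ i j : Fin 3, i ≠ j → slotSign L α w i ≠ slotSign L α w j → Circle.exp (cw i) ≠ Circle.exp (cw j)))}) := by
    intro w _
    refine ⟨fun hw j hj => ?_, fun h1 h2 => ⟨fun hwS => hxS w hwS, fun hwS => hinreg w hwS h1 h2⟩⟩
    rcases hw with rfl | rfl
    · rw [hkey _ h02₁ j hj]; exact fun h => h01₁ h.symm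
    · rw [hkey _ h02₂ j hj]; exact fun h => h01₂ h.symm
  obtain ⟨ε, hε, hball⟩ := Metric.isOpen_iff.1 (isOpen_pi_twoWallInRegBox L α S w₁ w₂) x hpbox
  have hKc : IsCompact (Metric.closedBall x (ε / 2)) := isCompact_closedBall x (ε / 2)
  have hKU : Metric.closedBall x (ε / 2) ⊆ Set.pi Set.univ (fun w : {w : InfinitePlace L // IsComplex w} => {cw : Fin 3 → ℝ |
        ((w = w₁ ∨ w = w₂) → ∀ j : Fin 3, j ≠ 1 → Circle.exp (cw 1) ≠ Circle.exp (cw j)) ∧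
        (w ≠ w₁ → w ≠ w₂ → (w ∈ S → cw 0 ≠ 0) ∧
          (w ∉ S → ∀ i j : Fin 3, i ≠ j → slotSign L α w i ≠ slotSign L α w j → Circle.exp (cw i) ≠ Circle.exp (cw j)))}) := (Metric.closedBall_subset_ball (by linarith)).trans hball
  have hwall₁ : ∀ j j' : Fin 3, j ≠ 1 → j' ≠ 1 → Circle.exp (p' w₁ j) = Circle.exp (p' w₁ j') := by rw [hx₁]; exact hwall w₁ h02₁
  have hwall₂ : ∀ j j' : Fin 3, j ≠ 1 → j' ≠ 1 → Circle.exp (p' w₂ j) = Circle.exp (p' w₂ j') := by rw [hx₂]; exact hwall w₂ h02₂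
  obtain ⟨𝒦', h𝒦', hmem𝒦⟩ := uniformlyProper_gprimeTorus_of_twoWall_inReg L α S w₁ w₂ p' q hα hreal hS hw₁ hw₂ hwall₁ hwall₂ hq hqp
    (fun w : {w : InfinitePlace L // IsComplex w} => {cw : Fin 3 → ℝ |
        ((w = w₁ ∨ w = w₂) → ∀ j : Fin 3, j ≠ 1 → Circle.exp (cw 1) ≠ Circle.exp (cw j)) ∧
        (w ≠ w₁ → w ≠ w₂ → (w ∈ S → cw 0 ≠ 0) ∧
          (w ∉ S → ∀ i j : Fin 3, i ≠ j → slotSign L α w i ≠ slotSign L α w j → Circle.exp (cw i) ≠ Circle.exp (cw j)))})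
    (fun cw hcw => hcw.1 (Or.inl rfl)) (fun cw hcw => hcw.1 (Or.inr rfl)) (fun w h1 h2 cw hcw => hcw.2 h1 h2)
    _ hKU hKc C' hC'
  obtain ⟨C'', hC'', hsub⟩ := exists_isCompact_image_mk_superset (Subgroup.centralizer ({gprimeTorus L α S p'} : Set ↥(arch (↥(maximalRealSubfield L)) L (IsCMField.complexConj L) 3 (Matrix.diagonal α)))) h𝒦'
  refine ⟨C'', Metric.ball x (ε / 2), hC'', Metric.isOpen_ball, Metric.mem_ball_self (half_pos hε), ?_⟩
  intro c hc y' hy'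
  obtain ⟨a, ha, hay⟩ := hsub (hmem𝒦 _ (Metric.ball_subset_closedBall hc) y' hy')
  rw [QuotientGroup.eq] at hay
  exact ⟨a, ha, a⁻¹ * y', hay, by group⟩

end Box

/-! ## §2 The descent identity on the in-regular box, with a jointly smooth family of two-block test functions -/

section Chart

variable (L : Type) [Field L] [NumberField L] [IsCMField L] (α : Fin 3 → L)
  [MeasurableSpace ↥(arch (↥(maximalRealSubfield L)) L (IsCMField.complexConj L) 3 (Matrix.diagonal α))]
  [BorelSpace ↥(arch (↥(maximalRealSubfield L)) L (IsCMField.complexConj L) 3 (Matrix.diagonal α))]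
  (ν' : Measure ↥(arch (↥(maximalRealSubfield L)) L (IsCMField.complexConj L) 3 (Matrix.diagonal α))) [ν'.IsHaarMeasure] [ν'.IsMulRightInvariant]

set_option maxHeartbeats 2400000 in
/-- **(X2) TWO-BLOCK DESCENT BOX, IN-REGULAR EDITION.**  House frame, admissible compact chart `S`, covered split-chart places `w₁ ≠ w₂ ∉ S`, a centre `x` with walls
`x_{w_i,0} = x_{w_i,2}`, `e^{ix_{w_i,0}} ≠ e^{ix_{w_i,1}}` at `w₁`, `w₂`, NO NONCOMPACT coincidence at the other places (compact ones allowed), `x_w ≠ 0` on `S`, `a′ ∈ C_c^∞(G′_∞)`, any Haar `μ₀` on `U(J)`: there are `K ≠ 0`, an open `U ∋ p` and a JOINTLY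
SMOOTH family `f : (coordinates) × (M₂(ℂ) × M₂(ℂ)) → ℂ` (an open `U ∋ x`), compactly supported in the matrix variables uniformly in `c` and depending on `c` only through the
double tangential point, such that for every `c ∈ U ∩ RegG S`
**`chartOrbG L α ν′ S a′ c = K · ∫_{U(J) × U(J)} f(c, ↑↑(q₁ · P diag(e^{i c_{w₁0}}, e^{i c_{w₁2}}) P⁻¹ · q₁⁻¹), ↑↑(q₂ · P diag(e^{i c_{w₂0}}, e^{i c_{w₂2}}) P⁻¹ · q₂⁻¹)) d(μ₀ ⊗ μ₀)(q)`**.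
[cite: Rogawski1990, §4.12 Lemma 4.12.1 p. 66; §8.2 pp. 119–124] [cite: HarishChandra1970, Part I §3 Lemma 22] [cite: Shelstad1979, §4 Lemma 4.3 (p. 25)] [cite: Folland1995, §2.6 (2.52)] -/
theorem exists_descent_twoBlock_box_chartOrbG_inReg (hα : ∀ i, α i ≠ 0)
    (hreal : ∀ (w : {w : InfinitePlace L // IsComplex w}) (i : Fin 3), (w.1.embedding (α i)).im = 0)
    {J : Matrix (Fin 2) (Fin 2) ℂ} (hJ : J = (StdForm.antidiagonal 2).over ℂ)
    [MeasurableSpace ↥(unitaryGroupOfForm (starRingEnd ℂ) J)] [BorelSpace ↥(unitaryGroupOfForm (starRingEnd ℂ) J)]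
    [LocallyCompactSpace ↥(unitaryGroupOfForm (starRingEnd ℂ) J)] [SecondCountableTopology ↥(unitaryGroupOfForm (starRingEnd ℂ) J)]
    (μ₀ : Measure ↥(unitaryGroupOfForm (starRingEnd ℂ) J)) [μ₀.IsHaarMeasure] [μ₀.IsMulRightInvariant]
    {S : Finset {w : InfinitePlace L // IsComplex w}} {w₁ w₂ : {w : InfinitePlace L // IsComplex w}} {x : {w : InfinitePlace L // IsComplex w} → Fin 3 → ℝ}
    (hS : ∀ w, w ∈ S → w ∈ splitChartPlaces L α) (hw₁ : w₁ ∉ S) (hw₂ : w₂ ∉ S) (h12 : w₁ ≠ w₂)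
    (hw₁sp : w₁ ∈ splitChartPlaces L α) (hw₂sp : w₂ ∈ splitChartPlaces L α)
    (h02₁ : x w₁ 0 = x w₁ 2) (h01₁ : Circle.exp (x w₁ 0) ≠ Circle.exp (x w₁ 1))
    (h02₂ : x w₂ 0 = x w₂ 2) (h01₂ : Circle.exp (x w₂ 0) ≠ Circle.exp (x w₂ 1))
    (hinreg : ∀ w, w ∉ S → w ≠ w₁ → w ≠ w₂ → ∀ i j : Fin 3, i ≠ j → slotSign L α w i ≠ slotSign L α w j → Circle.exp (x w i) ≠ Circle.exp (x w j))
    (hxS : ∀ w, w ∈ S → x w 0 ≠ 0)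
    {a' : ↥(arch (↥(maximalRealSubfield L)) L (IsCMField.complexConj L) 3 (Matrix.diagonal α)) → ℂ} (ha' : ArchSmooth L 3 (Matrix.diagonal α) a') :
    ∃ (K : ℂ) (U : Set ({w : InfinitePlace L // IsComplex w} → Fin 3 → ℝ)) (f : ({w : InfinitePlace L // IsComplex w} → Fin 3 → ℝ) × (Matrix (Fin 2) (Fin 2) ℂ × Matrix (Fin 2) (Fin 2) ℂ) → ℂ),
      K ≠ 0 ∧ IsOpen U ∧ x ∈ U ∧ ContDiff ℝ ∞ f ∧
      (∃ C : Set (Matrix (Fin 2) (Fin 2) ℂ × Matrix (Fin 2) (Fin 2) ℂ), IsCompact C ∧ ∀ c XY, XY ∉ C → f (c, XY) = 0) ∧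
      (∀ c XY, f (c, XY) = f (Function.update (Function.update c w₁ ![0, c w₁ 1, 0]) w₂ ![0, c w₂ 1, 0], XY)) ∧
      ∀ c ∈ U ∩ RegG S, chartOrbG L α ν' S a' c =
        K * ∫ q : ↥(unitaryGroupOfForm (starRingEnd ℂ) J) × ↥(unitaryGroupOfForm (starRingEnd ℂ) J),
          f (c, ((((q.1 * (⟨Matrix.GeneralLinearGroup.mkOfDetNeZero !![(1 : ℂ), 1; 1, -1] det_cayleyTwo_ne_zero *
              circleDiagonal 2 ![Circle.exp (c w₁ 0), Circle.exp (c w₁ 2)] * (Matrix.GeneralLinearGroup.mkOfDetNeZero !![(1 : ℂ), 1; 1, -1] det_cayleyTwo_ne_zero)⁻¹,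
            cayley_conj_circleDiagonal_mem_of_eq_over hJ _⟩ : ↥(unitaryGroupOfForm (starRingEnd ℂ) J)) * q.1⁻¹ : ↥(unitaryGroupOfForm (starRingEnd ℂ) J)) : GL (Fin 2) ℂ) : Matrix (Fin 2) (Fin 2) ℂ),
                 (((q.2 * (⟨Matrix.GeneralLinearGroup.mkOfDetNeZero !![(1 : ℂ), 1; 1, -1] det_cayleyTwo_ne_zero *
              circleDiagonal 2 ![Circle.exp (c w₂ 0), Circle.exp (c w₂ 2)] * (Matrix.GeneralLinearGroup.mkOfDetNeZero !![(1 : ℂ), 1; 1, -1] det_cayleyTwo_ne_zero)⁻¹,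
            cayley_conj_circleDiagonal_mem_of_eq_over hJ _⟩ : ↥(unitaryGroupOfForm (starRingEnd ℂ) J)) * q.2⁻¹ : ↥(unitaryGroupOfForm (starRingEnd ℂ) J)) : GL (Fin 2) ℂ) : Matrix (Fin 2) (Fin 2) ℂ))) ∂(μ₀.prod μ₀) := by
  -- ### frame facts
  have ha'c : Continuous a' := ha'.continuous
  have ha's : HasCompactSupport a' := ha'.hasCompactSupport
  obtain ⟨hreal2₁, hsgn₁⟩ := blockWeights_of_mem_splitChartPlaces L α w₁ hw₁sp
  obtain ⟨hreal2₂, hsgn₂⟩ := blockWeights_of_mem_splitChartPlaces L α w₂ hw₂sp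
  -- ### the regularised base point `p′` (the centre at `w₁, w₂` and on `S`, a regular point `c₀` elsewhere) and the regular comparison point `q`
  obtain ⟨c₀, hc₀⟩ := (dense_regG S).nonempty
  obtain ⟨p, hp⟩ : ∃ p : {w : InfinitePlace L // IsComplex w} → Fin 3 → ℝ, p = fun w => if w = w₁ ∨ w = w₂ ∨ w ∈ S then x w else c₀ w := ⟨_, rfl⟩
  obtain ⟨q, hq⟩ : ∃ q : {w : InfinitePlace L // IsComplex w} → Fin 3 → ℝ, q = fun w => if w ∈ S then x w else c₀ w := ⟨_, rfl⟩
  have hp₁ : p w₁ = x w₁ := by rw [hp]; exact if_pos (Or.inl rfl)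
  have hp₂ : p w₂ = x w₂ := by rw [hp]; exact if_pos (Or.inr (Or.inl rfl))
  have hpS : ∀ w, w ∈ S → p w = x w := fun w hw => by rw [hp]; exact if_pos (Or.inr (Or.inr hw))
  have hpc : ∀ w, w ≠ w₁ → w ≠ w₂ → w ∉ S → p w = c₀ w := fun w h1 h2 hw => by
    rw [hp]; exact if_neg (by rintro (h | h | h) <;> [exact h1 h; exact h2 h; exact hw h])
  have hqreg : q ∈ RegG S := by
    refine ⟨fun w hw => ?_, fun w hw => ?_⟩
    · have h : q w = c₀ w := by rw [hq]; exact if_neg hw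
      rw [h]; exact hc₀.1 w hw
    · have h : q w = x w := by rw [hq]; exact if_pos hw
      rw [h]; exact hxS w hw
  have hqp : ∀ w, w ≠ w₁ → w ≠ w₂ → q w = p w := by
    intro w h1 h2
    by_cases hw : w ∈ S
    · rw [hpS w hw, hq]; exact if_pos hw
    · rw [hpc w h1 h2 hw, hq]; exact if_neg hw
  have h02c₁ : Circle.exp (p w₁ 0) = Circle.exp (p w₁ 2) := by rw [hp₁, h02₁]
  have h02c₂ : Circle.exp (p w₂ 0) = Circle.exp (p w₂ 2) := by rw [hp₂, h02₂]
  have h01₁' : Circle.exp (p w₁ 0) ≠ Circle.exp (p w₁ 1) := by rw [hp₁]; exact h01₁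
  have h01₂' : Circle.exp (p w₂ 0) ≠ Circle.exp (p w₂ 1) := by rw [hp₂]; exact h01₂
  have hreg : ∀ w, w ≠ w₁ → w ≠ w₂ → w ∉ S → Function.Injective fun i : Fin 3 => Circle.exp (p w i) := fun w h1 h2 hw => by
    rw [hpc w h1 h2 hw]; exact hc₀.1 w hw
  have hregS : ∀ w, w ∈ S → p w 0 ≠ 0 := fun w hw => by rw [hpS w hw]; exact hxS w hw
  -- ### (X2-M): `e : Z(γ_p) ≃ₜ* (B₁ × B₂) × K` with its clauses
  refine (exists_continuousMulEquiv_centralizer_gprimeTorus_twoWall_explicit L α S w₁ w₂ hα hS hw₁ hw₂ h12 p h02c₁ h01₁' h02c₂ h01₂' hreg hregS).elim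
    fun K hK => hK.elim fun e he => ?_
  obtain ⟨hKc, hKsub, hKcomm, h4, h5₁, h5₂, h6, hmapT, h8₁, h8₂, h9₁, h9₂, h10⟩ := he
  -- ### (B-STD) at both places: `φ_i : B_i ≃ₜ* U(J)` with the torus clause and the frame matrix
  obtain ⟨φ₁, hφ₁, hval₁⟩ := exists_continuousMulEquiv_diagonal_weights_std (L := L) w₁.1.embedding ![α (lineOf (formSign L α w₁) 0), α (lineOf (formSign L α w₁) 2)] hreal2₁ hsgn₁ hJ
  obtain ⟨φ₂, hφ₂, hval₂⟩ := exists_continuousMulEquiv_diagonal_weights_std (L := L) w₂.1.embedding ![α (lineOf (formSign L α w₂) 0), α (lineOf (formSign L α w₂) 2)] hreal2₂ hsgn₂ hJ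
  -- `e′ := (φ₁ × φ₂ × id) ∘ e : Z(γ_p) ≃ₜ* (U(J) × U(J)) × K`
  let ψ : ↥(Subgroup.centralizer ({gprimeTorus L α S p} : Set ↥(arch (↥(maximalRealSubfield L)) L (IsCMField.complexConj L) 3 (Matrix.diagonal α)))) ≃* (↥(unitaryGroupOfForm (starRingEnd ℂ) J) × ↥(unitaryGroupOfForm (starRingEnd ℂ) J)) × ↥K :=
    e.toMulEquiv.trans (MulEquiv.prodCongr (MulEquiv.prodCongr φ₁.toMulEquiv φ₂.toMulEquiv) (MulEquiv.refl ↥K))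
  have hψc : Continuous ψ := by
    show Continuous fun g => ((φ₁ (e g).1.1, φ₂ (e g).1.2), (e g).2)
    exact ((φ₁.continuous.comp (continuous_fst.comp (continuous_fst.comp e.continuous))).prodMk
      (φ₂.continuous.comp (continuous_snd.comp (continuous_fst.comp e.continuous)))).prodMk (continuous_snd.comp e.continuous)
  have hψsc : Continuous ψ.symm := by
    show Continuous fun q : (↥(unitaryGroupOfForm (starRingEnd ℂ) J) × ↥(unitaryGroupOfForm (starRingEnd ℂ) J)) × ↥K => e.symm ((φ₁.symm q.1.1, φ₂.symm q.1.2), q.2)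
    exact e.symm.continuous.comp (((φ₁.symm.continuous.comp (continuous_fst.comp continuous_fst)).prodMk
      (φ₂.symm.continuous.comp (continuous_snd.comp continuous_fst))).prodMk continuous_snd)
  let e' : ↥(Subgroup.centralizer ({gprimeTorus L α S p} : Set ↥(arch (↥(maximalRealSubfield L)) L (IsCMField.complexConj L) 3 (Matrix.diagonal α)))) ≃ₜ* (↥(unitaryGroupOfForm (starRingEnd ℂ) J) × ↥(unitaryGroupOfForm (starRingEnd ℂ) J)) × ↥K := { ψ with continuous_toFun := hψc, continuous_invFun := hψsc }
  have he' : ∀ g, e' g = ((φ₁ (e g).1.1, φ₂ (e g).1.2), (e g).2) := fun _ => rfl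
  have he's : ∀ q, e'.symm q = e.symm ((φ₁.symm q.1.1, φ₂.symm q.1.2), q.2) := fun _ => rfl
  -- ### the chart torus sits inside `Z(γ_p)`; the block torus `A = φ₁(A₁) × φ₂(A₂)`
  have hT : chartTorusG L α S ≤ Subgroup.centralizer ({gprimeTorus L α S p} : Set ↥(arch (↥(maximalRealSubfield L)) L (IsCMField.complexConj L) 3 (Matrix.diagonal α))) := chartTorusG_le_centralizer L α S p
  let A : Subgroup (↥(unitaryGroupOfForm (starRingEnd ℂ) J) × ↥(unitaryGroupOfForm (starRingEnd ℂ) J)) :=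
    (Subgroup.map (φ₁ : ↥(unitaryGroupOfForm (starRingEnd ℂ) ((Matrix.diagonal ![α (lineOf (formSign L α w₁) 0), α (lineOf (formSign L α w₁) 2)]).map w₁.1.embedding)) →* ↥(unitaryGroupOfForm (starRingEnd ℂ) J)) (((circleDiagonal 2).codRestrict (unitaryGroupOfForm (starRingEnd ℂ) ((Matrix.diagonal ![α (lineOf (formSign L α w₁) 0), α (lineOf (formSign L α w₁) 2)]).map w₁.1.embedding))
      (circleDiagonal_mem_archLocal_diagonal L 2 ![α (lineOf (formSign L α w₁) 0), α (lineOf (formSign L α w₁) 2)] w₁)).range)).prod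
    (Subgroup.map (φ₂ : ↥(unitaryGroupOfForm (starRingEnd ℂ) ((Matrix.diagonal ![α (lineOf (formSign L α w₂) 0), α (lineOf (formSign L α w₂) 2)]).map w₂.1.embedding)) →* ↥(unitaryGroupOfForm (starRingEnd ℂ) J)) (((circleDiagonal 2).codRestrict (unitaryGroupOfForm (starRingEnd ℂ) ((Matrix.diagonal ![α (lineOf (formSign L α w₂) 0), α (lineOf (formSign L α w₂) 2)]).map w₂.1.embedding))
      (circleDiagonal_mem_archLocal_diagonal L 2 ![α (lineOf (formSign L α w₂) 0), α (lineOf (formSign L α w₂) 2)] w₂)).range))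
  have hmemA : ∀ q : ↥(unitaryGroupOfForm (starRingEnd ℂ) J) × ↥(unitaryGroupOfForm (starRingEnd ℂ) J), q ∈ A ↔
      ((φ₁.symm q.1 : ↥(unitaryGroupOfForm (starRingEnd ℂ) ((Matrix.diagonal ![α (lineOf (formSign L α w₁) 0), α (lineOf (formSign L α w₁) 2)]).map w₁.1.embedding))) : GL (Fin 2) ℂ) ∈ Set.range (circleDiagonal 2) ∧
      ((φ₂.symm q.2 : ↥(unitaryGroupOfForm (starRingEnd ℂ) ((Matrix.diagonal ![α (lineOf (formSign L α w₂) 0), α (lineOf (formSign L α w₂) 2)]).map w₂.1.embedding))) : GL (Fin 2) ℂ) ∈ Set.range (circleDiagonal 2) := by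
    intro q
    simp only [A, Subgroup.mem_prod, Subgroup.mem_map, MonoidHom.mem_range, MonoidHom.coe_coe, MonoidHom.codRestrict_apply]
    constructor
    · rintro ⟨⟨b₁, ⟨u, rfl⟩, hb₁⟩, ⟨b₂, ⟨v, rfl⟩, hb₂⟩⟩
      refine ⟨⟨u, ?_⟩, ⟨v, ?_⟩⟩
      · rw [← hb₁, ContinuousMulEquiv.symm_apply_apply]
      · rw [← hb₂, ContinuousMulEquiv.symm_apply_apply]
    · rintro ⟨⟨u, hu⟩, ⟨v, hv⟩⟩
      refine ⟨⟨φ₁.symm q.1, ⟨u, Subtype.ext hu⟩, φ₁.apply_symm_apply _⟩, ⟨φ₂.symm q.2, ⟨v, Subtype.ext hv⟩, φ₂.apply_symm_apply _⟩⟩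
  have hTA' : ∀ g : ↥(Subgroup.centralizer ({gprimeTorus L α S p} : Set ↥(arch (↥(maximalRealSubfield L)) L (IsCMField.complexConj L) 3 (Matrix.diagonal α)))), g ∈ (chartTorusG L α S).subgroupOf (Subgroup.centralizer ({gprimeTorus L α S p} : Set ↥(arch (↥(maximalRealSubfield L)) L (IsCMField.complexConj L) 3 (Matrix.diagonal α)))) ↔ (e' g).1 ∈ A := by
    intro g
    rw [Subgroup.mem_subgroupOf, h4 g, hmemA, he']
    simp only [ContinuousMulEquiv.symm_apply_apply]
  have hmapT' : Subgroup.map (e' : ↥(Subgroup.centralizer ({gprimeTorus L α S p} : Set ↥(arch (↥(maximalRealSubfield L)) L (IsCMField.complexConj L) 3 (Matrix.diagonal α)))) →* (↥(unitaryGroupOfForm (starRingEnd ℂ) J) × ↥(unitaryGroupOfForm (starRingEnd ℂ) J)) × ↥K) ((chartTorusG L α S).subgroupOf (Subgroup.centralizer ({gprimeTorus L α S p} : Set ↥(arch (↥(maximalRealSubfield L)) L (IsCMField.complexConj L) 3 (Matrix.diagonal α))))) = A.prod ⊤ := by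
    ext q
    simp only [Subgroup.mem_map, Subgroup.mem_prod, Subgroup.mem_top, and_true, MonoidHom.coe_coe]
    constructor
    · rintro ⟨g, hg, rfl⟩
      exact (hTA' g).1 hg
    · intro hq
      refine ⟨e'.symm q, (hTA' _).2 ?_, e'.apply_symm_apply q⟩
      rw [e'.apply_symm_apply]
      exact hq
  -- ### instances on `Z(γ_p)`, its quotient, `K`, `U(J) × U(J)`, `(U(J) × U(J)) ⧸ A`
  have hZc : IsClosed ((Subgroup.centralizer ({gprimeTorus L α S p} : Set ↥(arch (↥(maximalRealSubfield L)) L (IsCMField.complexConj L) 3 (Matrix.diagonal α)))) : Set ↥(arch (↥(maximalRealSubfield L)) L (IsCMField.complexConj L) 3 (Matrix.diagonal α))) := isClosed_centralizer_singleton_of_t2 _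
  haveI : LocallyCompactSpace ↥(Subgroup.centralizer ({gprimeTorus L α S p} : Set ↥(arch (↥(maximalRealSubfield L)) L (IsCMField.complexConj L) 3 (Matrix.diagonal α)))) := hZc.isClosedEmbedding_subtypeVal.locallyCompactSpace
  haveI : SecondCountableTopology ↥(Subgroup.centralizer ({gprimeTorus L α S p} : Set ↥(arch (↥(maximalRealSubfield L)) L (IsCMField.complexConj L) 3 (Matrix.diagonal α)))) := TopologicalSpace.Subtype.secondCountableTopology _
  letI : MeasurableSpace (↥(Subgroup.centralizer ({gprimeTorus L α S p} : Set ↥(arch (↥(maximalRealSubfield L)) L (IsCMField.complexConj L) 3 (Matrix.diagonal α)))) ⧸ (chartTorusG L α S).subgroupOf (Subgroup.centralizer ({gprimeTorus L α S p} : Set ↥(arch (↥(maximalRealSubfield L)) L (IsCMField.complexConj L) 3 (Matrix.diagonal α))))) := borel _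
  haveI : BorelSpace (↥(Subgroup.centralizer ({gprimeTorus L α S p} : Set ↥(arch (↥(maximalRealSubfield L)) L (IsCMField.complexConj L) 3 (Matrix.diagonal α)))) ⧸ (chartTorusG L α S).subgroupOf (Subgroup.centralizer ({gprimeTorus L α S p} : Set ↥(arch (↥(maximalRealSubfield L)) L (IsCMField.complexConj L) 3 (Matrix.diagonal α))))) := ⟨rfl⟩
  haveI : LocallyCompactSpace ↥K := hKc.isClosedEmbedding_subtypeVal.locallyCompactSpace
  haveI : SecondCountableTopology ↥K := TopologicalSpace.Subtype.secondCountableTopology _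
  letI : MeasurableSpace ↥K := borel _
  haveI : BorelSpace ↥K := ⟨rfl⟩
  letI : MeasurableSpace ((↥(unitaryGroupOfForm (starRingEnd ℂ) J) × ↥(unitaryGroupOfForm (starRingEnd ℂ) J)) ⧸ A) := borel _
  haveI : BorelSpace ((↥(unitaryGroupOfForm (starRingEnd ℂ) J) × ↥(unitaryGroupOfForm (starRingEnd ℂ) J)) ⧸ A) := ⟨rfl⟩
  haveI : CompactSpace ↥(Subgroup.map (φ₁ : ↥(unitaryGroupOfForm (starRingEnd ℂ) ((Matrix.diagonal ![α (lineOf (formSign L α w₁) 0), α (lineOf (formSign L α w₁) 2)]).map w₁.1.embedding)) →* ↥(unitaryGroupOfForm (starRingEnd ℂ) J)) (((circleDiagonal 2).codRestrict (unitaryGroupOfForm (starRingEnd ℂ) ((Matrix.diagonal ![α (lineOf (formSign L α w₁) 0), α (lineOf (formSign L α w₁) 2)]).map w₁.1.embedding))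
      (circleDiagonal_mem_archLocal_diagonal L 2 ![α (lineOf (formSign L α w₁) 0), α (lineOf (formSign L α w₁) 2)] w₁)).range)) :=
    isCompact_iff_compactSpace.mp (isCompact_map_circleDiagonal_range L α w₁ φ₁)
  haveI : CompactSpace ↥(Subgroup.map (φ₂ : ↥(unitaryGroupOfForm (starRingEnd ℂ) ((Matrix.diagonal ![α (lineOf (formSign L α w₂) 0), α (lineOf (formSign L α w₂) 2)]).map w₂.1.embedding)) →* ↥(unitaryGroupOfForm (starRingEnd ℂ) J)) (((circleDiagonal 2).codRestrict (unitaryGroupOfForm (starRingEnd ℂ) ((Matrix.diagonal ![α (lineOf (formSign L α w₂) 0), α (lineOf (formSign L α w₂) 2)]).map w₂.1.embedding))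
      (circleDiagonal_mem_archLocal_diagonal L 2 ![α (lineOf (formSign L α w₂) 0), α (lineOf (formSign L α w₂) 2)] w₂)).range)) :=
    isCompact_iff_compactSpace.mp (isCompact_map_circleDiagonal_range L α w₂ φ₂)
  have hAcpt : IsCompact ((A : Subgroup (↥(unitaryGroupOfForm (starRingEnd ℂ) J) × ↥(unitaryGroupOfForm (starRingEnd ℂ) J))) : Set (↥(unitaryGroupOfForm (starRingEnd ℂ) J) × ↥(unitaryGroupOfForm (starRingEnd ℂ) J))) := by
    rw [Subgroup.coe_prod]
    exact (isCompact_map_circleDiagonal_range L α w₁ φ₁).prod (isCompact_map_circleDiagonal_range L α w₂ φ₂)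
  haveI : CompactSpace ↥A := isCompact_iff_compactSpace.mp hAcpt
  have hA : IsClosed ((A : Subgroup (↥(unitaryGroupOfForm (starRingEnd ℂ) J) × ↥(unitaryGroupOfForm (starRingEnd ℂ) J))) : Set (↥(unitaryGroupOfForm (starRingEnd ℂ) J) × ↥(unitaryGroupOfForm (starRingEnd ℂ) J))) := hAcpt.isClosed
  -- `A` is commutative (both factors are images of the commutative unit-diagonal tori)
  have hcommA₁ : ∀ x y : ↥(unitaryGroupOfForm (starRingEnd ℂ) ((Matrix.diagonal ![α (lineOf (formSign L α w₁) 0), α (lineOf (formSign L α w₁) 2)]).map w₁.1.embedding)), (x : GL (Fin 2) ℂ) ∈ Set.range (circleDiagonal 2) → (y : GL (Fin 2) ℂ) ∈ Set.range (circleDiagonal 2) → x * y = y * x := by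
    rintro x y ⟨u, hu⟩ ⟨v, hv⟩
    apply Subtype.ext
    show (x : GL (Fin 2) ℂ) * y = y * x
    rw [← hu, ← hv, ← map_mul, ← map_mul, mul_comm]
  have hcommA₂ : ∀ x y : ↥(unitaryGroupOfForm (starRingEnd ℂ) ((Matrix.diagonal ![α (lineOf (formSign L α w₂) 0), α (lineOf (formSign L α w₂) 2)]).map w₂.1.embedding)), (x : GL (Fin 2) ℂ) ∈ Set.range (circleDiagonal 2) → (y : GL (Fin 2) ℂ) ∈ Set.range (circleDiagonal 2) → x * y = y * x := by
    rintro x y ⟨u, hu⟩ ⟨v, hv⟩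
    apply Subtype.ext
    show (x : GL (Fin 2) ℂ) * y = y * x
    rw [← hu, ← hv, ← map_mul, ← map_mul, mul_comm]
  have hAcomm : ∀ a b : ↥A, a * b = b * a := by
    intro a b
    obtain ⟨ha₁, ha₂⟩ := (hmemA a.1).1 a.2
    obtain ⟨hb₁, hb₂⟩ := (hmemA b.1).1 b.2
    apply Subtype.ext
    show (a : ↥(unitaryGroupOfForm (starRingEnd ℂ) J) × ↥(unitaryGroupOfForm (starRingEnd ℂ) J)) * b = b * a
    refine Prod.ext (φ₁.symm.injective ?_) (φ₂.symm.injective ?_)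
    · show φ₁.symm ((a : ↥(unitaryGroupOfForm (starRingEnd ℂ) J) × ↥(unitaryGroupOfForm (starRingEnd ℂ) J)).1 * (b : ↥(unitaryGroupOfForm (starRingEnd ℂ) J) × ↥(unitaryGroupOfForm (starRingEnd ℂ) J)).1) = φ₁.symm ((b : ↥(unitaryGroupOfForm (starRingEnd ℂ) J) × ↥(unitaryGroupOfForm (starRingEnd ℂ) J)).1 * (a : ↥(unitaryGroupOfForm (starRingEnd ℂ) J) × ↥(unitaryGroupOfForm (starRingEnd ℂ) J)).1)
      rw [map_mul, map_mul]; exact hcommA₁ _ _ ha₁ hb₁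
    · show φ₂.symm ((a : ↥(unitaryGroupOfForm (starRingEnd ℂ) J) × ↥(unitaryGroupOfForm (starRingEnd ℂ) J)).2 * (b : ↥(unitaryGroupOfForm (starRingEnd ℂ) J) × ↥(unitaryGroupOfForm (starRingEnd ℂ) J)).2) = φ₂.symm ((b : ↥(unitaryGroupOfForm (starRingEnd ℂ) J) × ↥(unitaryGroupOfForm (starRingEnd ℂ) J)).2 * (a : ↥(unitaryGroupOfForm (starRingEnd ℂ) J) × ↥(unitaryGroupOfForm (starRingEnd ℂ) J)).2)
      rw [map_mul, map_mul]; exact hcommA₂ _ _ ha₂ hb₂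
  -- ### `Ψ : Z(γ_p) ⧸ T′ ≃ₜ (U(J) × U(J)) ⧸ A` (★ (M-UNFOLD) PART 2)
  obtain ⟨Ψ, -, hΨ⟩ := exists_quotient_homeomorph_of_map_eq_prod_top ((chartTorusG L α S).subgroupOf (Subgroup.centralizer ({gprimeTorus L α S p} : Set ↥(arch (↥(maximalRealSubfield L)) L (IsCMField.complexConj L) 3 (Matrix.diagonal α))))) A e' hmapT'
  -- ### a right- and inversion-invariant Haar measure on `Z(γ_p)` (★ p850728)
  obtain ⟨νM, hνM1, hνM2, hνM3⟩ := exists_isHaarMeasure_isMulRightInvariant_isInvInvariant_centralizer_arch (↥(maximalRealSubfield L)) L (IsCMField.complexConj L) 3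
    (Matrix.diagonal α) ({gprimeTorus L α S p} : Set ↥(arch (↥(maximalRealSubfield L)) L (IsCMField.complexConj L) 3 (Matrix.diagonal α))) K hKc hKcomm e' (μ₀.prod μ₀)
  haveI := hνM1; haveI := hνM2; haveI := hνM3
  -- ### the descent scalar `κ`: `Ψ_*(νM ∕ dt′) = κ • π_* (μ₀ ⊗ μ₀)` (★ `exists_smul_map_mk_of_block_compact`)
  haveI := isHaarMeasure_chartHaarG L α S
  haveI := isInvInvariant_chartHaarG L α S
  haveI := isHaarMeasure_map_subgroupOfEquivOfLe_symm hT (chartHaarG L α S)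
  haveI := isInvInvariant_map_subgroupOfEquivOfLe_symm hT (chartHaarG L α S)
  have hTc := isClosed_subgroupOf_of_isClosed _ (Subgroup.centralizer ({gprimeTorus L α S p} : Set ↥(arch (↥(maximalRealSubfield L)) L (IsCMField.complexConj L) 3 (Matrix.diagonal α)))) (isClosed_chartTorusG L α S)
  letI : CommGroup ↥K := { (inferInstance : Group ↥K) with mul_comm := fun a b => Subtype.ext (hKcomm _ a.2 _ b.2) }
  let νK : Measure ↥K := haarMeasure (Classical.arbitrary (TopologicalSpace.PositiveCompacts ↥K))
  haveI : νK.IsInvInvariant := IsHaarMeasure.isInvInvariant_of_regular νK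
  haveI : νK.IsMulRightInvariant := isMulRightInvariant_of_isInvInvariant νK
  letI : CommGroup ↥A := { (inferInstance : Group ↥A) with mul_comm := hAcomm }
  let ρA : Measure ↥A := haarMeasure (Classical.arbitrary (TopologicalSpace.PositiveCompacts _))
  haveI : ρA.IsInvInvariant := IsHaarMeasure.isInvInvariant_of_regular ρA
  obtain ⟨κ, hκ, hmap, -⟩ := exists_smul_map_mk_of_block_compact e' ((chartTorusG L α S).subgroupOf _) hTc A hA hTA' Ψ hΨ
    (Measure.map (Subgroup.subgroupOfEquivOfLe hT).symm (chartHaarG L α S)) νM ρA (μ₀.prod μ₀) νK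
  -- ### Harish-Chandra's compactness on the in-regular box around `x` modulo `Z(γ_{p′})` (§1) and ONE cut-off `β` (★ p850338)
  obtain ⟨CS, U, hCSc, hUo, hpU, hCM⟩ := exists_isCompact_mul_centralizer_inRegBox_twoWall L α S w₁ w₂ p q x hα hreal hS hw₁ hw₂ hp₁ hp₂ h02₁ h01₁ h02₂ h01₂
    hinreg hxS hqreg hqp ha's.isCompact
  obtain ⟨β, hβc, hβs, hβ0, -, hβ1⟩ := exists_continuous_hasCompactSupport_integral_comp_mul_eq_one_pos (Subgroup.centralizer ({gprimeTorus L α S p} : Set ↥(arch (↥(maximalRealSubfield L)) L (IsCMField.complexConj L) 3 (Matrix.diagonal α)))) hZc νM (hCSc.insert 1)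
  have hβ1S : ∀ x ∈ CS, ∀ k₀ : ↥(Subgroup.centralizer ({gprimeTorus L α S p} : Set ↥(arch (↥(maximalRealSubfield L)) L (IsCMField.complexConj L) 3 (Matrix.diagonal α)))), ∫ h : ↥(Subgroup.centralizer ({gprimeTorus L α S p} : Set ↥(arch (↥(maximalRealSubfield L)) L (IsCMField.complexConj L) 3 (Matrix.diagonal α)))), β (x * (k₀ : ↥(arch (↥(maximalRealSubfield L)) L (IsCMField.complexConj L) 3 (Matrix.diagonal α))) * (h : ↥(arch (↥(maximalRealSubfield L)) L (IsCMField.complexConj L) 3 (Matrix.diagonal α)))) ∂νM = 1 :=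
    fun x hx k₀ => hβ1 x (Set.mem_insert_of_mem _ hx) k₀
  -- ### the descended function `(a′)_M^β` and its SMOOTH ambient reading (★ aM-SMOOTH, ★ eM-SMOOTH at both places, the frame matrices of `φ₁`, `φ₂`)
  have haMc : Continuous (fun m : ↥(Subgroup.centralizer ({gprimeTorus L α S p} : Set ↥(arch (↥(maximalRealSubfield L)) L (IsCMField.complexConj L) 3 (Matrix.diagonal α)))) => ∫ x, β x • a' (x * (m : ↥(arch (↥(maximalRealSubfield L)) L (IsCMField.complexConj L) 3 (Matrix.diagonal α))) * x⁻¹) ∂ν') := continuous_integral_conj_subtype ν' _ hβc hβs ha'c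
  have haMs : HasCompactSupport (fun m : ↥(Subgroup.centralizer ({gprimeTorus L α S p} : Set ↥(arch (↥(maximalRealSubfield L)) L (IsCMField.complexConj L) 3 (Matrix.diagonal α)))) => ∫ x, β x • a' (x * (m : ↥(arch (↥(maximalRealSubfield L)) L (IsCMField.complexConj L) 3 (Matrix.diagonal α))) * x⁻¹) ∂ν') := hasCompactSupport_integral_conj ν' _ hZc hβs ha's
  obtain ⟨ΘM, hΘM, haM⟩ := exists_contDiff_descended_eq L 3 (Matrix.diagonal α) ν' ha' β hβc hβs (Subgroup.centralizer ({gprimeTorus L α S p} : Set ↥(arch (↥(maximalRealSubfield L)) L (IsCMField.complexConj L) 3 (Matrix.diagonal α))))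
  obtain ⟨Λ₁, hΛ₁, hΛ₁b⟩ := exists_contDiff_coe_symm_archPiEquivCM_mulSingle_relabel_endoEmb L α w₁ (lineOf (formSign L α w₁))
  obtain ⟨Λ₂, hΛ₂, hΛ₂b⟩ := exists_contDiff_coe_symm_archPiEquivCM_mulSingle_relabel_endoEmb L α w₂ (lineOf (formSign L α w₂))
  have hΛ₁b' : ∀ b : ↥(unitaryGroupOfForm (starRingEnd ℂ) ((Matrix.diagonal ![α (lineOf (formSign L α w₁) 0), α (lineOf (formSign L α w₁) 2)]).map w₁.1.embedding)), ((((e.symm ((b, 1), 1) : ↥(Subgroup.centralizer ({gprimeTorus L α S p} : Set ↥(arch (↥(maximalRealSubfield L)) L (IsCMField.complexConj L) 3 (Matrix.diagonal α))))) : ↥(arch (↥(maximalRealSubfield L)) L (IsCMField.complexConj L) 3 (Matrix.diagonal α))) : GL (Fin 3) (mixedSpace L)) : Matrix (Fin 3) (Fin 3) (mixedSpace L)) = Λ₁ ((b : GL (Fin 2) ℂ) : Matrix (Fin 2) (Fin 2) ℂ) :=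
    fun b => by rw [h8₁ b]; exact hΛ₁b b
  have hΛ₂b' : ∀ b : ↥(unitaryGroupOfForm (starRingEnd ℂ) ((Matrix.diagonal ![α (lineOf (formSign L α w₂) 0), α (lineOf (formSign L α w₂) 2)]).map w₂.1.embedding)), ((((e.symm ((1, b), 1) : ↥(Subgroup.centralizer ({gprimeTorus L α S p} : Set ↥(arch (↥(maximalRealSubfield L)) L (IsCMField.complexConj L) 3 (Matrix.diagonal α))))) : ↥(arch (↥(maximalRealSubfield L)) L (IsCMField.complexConj L) 3 (Matrix.diagonal α))) : GL (Fin 3) (mixedSpace L)) : Matrix (Fin 3) (Fin 3) (mixedSpace L)) = Λ₂ ((b : GL (Fin 2) ℂ) : Matrix (Fin 2) (Fin 2) ℂ) :=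
    fun b => by rw [h8₂ b]; exact hΛ₂b b
  obtain ⟨M1, hM1⟩ : ∃ M1 : GL (Fin 2) ℂ, ∀ h : ↥(unitaryGroupOfForm (starRingEnd ℂ) ((Matrix.diagonal ![α (lineOf (formSign L α w₁) 0), α (lineOf (formSign L α w₁) 2)]).map w₁.1.embedding)), ((φ₁ h : ↥(unitaryGroupOfForm (starRingEnd ℂ) J)) : GL (Fin 2) ℂ) = M1 * (h : GL (Fin 2) ℂ) * M1⁻¹ :=
    ⟨_, fun h => by rw [hval₁ h, _root_.mul_inv_rev]⟩
  obtain ⟨M2, hM2⟩ : ∃ M2 : GL (Fin 2) ℂ, ∀ h : ↥(unitaryGroupOfForm (starRingEnd ℂ) ((Matrix.diagonal ![α (lineOf (formSign L α w₂) 0), α (lineOf (formSign L α w₂) 2)]).map w₂.1.embedding)), ((φ₂ h : ↥(unitaryGroupOfForm (starRingEnd ℂ) J)) : GL (Fin 2) ℂ) = M2 * (h : GL (Fin 2) ℂ) * M2⁻¹ :=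
    ⟨_, fun h => by rw [hval₂ h, _root_.mul_inv_rev]⟩
  have hφsymm₁ : ∀ u : ↥(unitaryGroupOfForm (starRingEnd ℂ) J), (((φ₁.symm u : ↥(unitaryGroupOfForm (starRingEnd ℂ) ((Matrix.diagonal ![α (lineOf (formSign L α w₁) 0), α (lineOf (formSign L α w₁) 2)]).map w₁.1.embedding))) : GL (Fin 2) ℂ) : Matrix (Fin 2) (Fin 2) ℂ) = ((M1⁻¹ : GL (Fin 2) ℂ) : Matrix (Fin 2) (Fin 2) ℂ) * ((u : GL (Fin 2) ℂ) : Matrix (Fin 2) (Fin 2) ℂ) * ((M1 : GL (Fin 2) ℂ) : Matrix (Fin 2) (Fin 2) ℂ) := fun u => by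
    have h := hM1 (φ₁.symm u)
    rw [ContinuousMulEquiv.apply_symm_apply] at h
    have h' : ((φ₁.symm u : ↥(unitaryGroupOfForm (starRingEnd ℂ) ((Matrix.diagonal ![α (lineOf (formSign L α w₁) 0), α (lineOf (formSign L α w₁) 2)]).map w₁.1.embedding))) : GL (Fin 2) ℂ) = M1⁻¹ * (u : GL (Fin 2) ℂ) * M1 := by rw [h]; group
    rw [h', Units.val_mul, Units.val_mul]
  have hφsymm₂ : ∀ u : ↥(unitaryGroupOfForm (starRingEnd ℂ) J), (((φ₂.symm u : ↥(unitaryGroupOfForm (starRingEnd ℂ) ((Matrix.diagonal ![α (lineOf (formSign L α w₂) 0), α (lineOf (formSign L α w₂) 2)]).map w₂.1.embedding))) : GL (Fin 2) ℂ) : Matrix (Fin 2) (Fin 2) ℂ) = ((M2⁻¹ : GL (Fin 2) ℂ) : Matrix (Fin 2) (Fin 2) ℂ) * ((u : GL (Fin 2) ℂ) : Matrix (Fin 2) (Fin 2) ℂ) * ((M2 : GL (Fin 2) ℂ) : Matrix (Fin 2) (Fin 2) ℂ) := fun u => by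
    have h := hM2 (φ₂.symm u)
    rw [ContinuousMulEquiv.apply_symm_apply] at h
    have h' : ((φ₂.symm u : ↥(unitaryGroupOfForm (starRingEnd ℂ) ((Matrix.diagonal ![α (lineOf (formSign L α w₂) 0), α (lineOf (formSign L α w₂) 2)]).map w₂.1.embedding))) : GL (Fin 2) ℂ) = M2⁻¹ * (u : GL (Fin 2) ℂ) * M2 := by rw [h]; group
    rw [h', Units.val_mul, Units.val_mul]
  -- `e′⁻¹((u₁, u₂), r) = e⁻¹((φ₁⁻¹ u₁, 1), 1) · e⁻¹((1, φ₂⁻¹ u₂), 1) · r` for every `r ∈ K` (clause [10])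
  have hsymm : ∀ (u₁ u₂ : ↥(unitaryGroupOfForm (starRingEnd ℂ) J)) (r : ↥K), e'.symm ((u₁, u₂), r) = e.symm ((φ₁.symm u₁, 1), 1) * e.symm ((1, φ₂.symm u₂), 1) * (r : ↥(Subgroup.centralizer ({gprimeTorus L α S p} : Set ↥(arch (↥(maximalRealSubfield L)) L (IsCMField.complexConj L) 3 (Matrix.diagonal α))))) := by
    intro u₁ u₂ r
    rw [he's]
    apply e.injective
    rw [ContinuousMulEquiv.apply_symm_apply, map_mul, map_mul, ContinuousMulEquiv.apply_symm_apply, ContinuousMulEquiv.apply_symm_apply, h10 _ r.2]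
    ext <;> simp
  -- ONE ambient cut-off `χ ≡ 1` on the common compact matrix support of all the block test functions
  have hS₀ : IsCompact ((fun u : ↥(unitaryGroupOfForm (starRingEnd ℂ) J) × ↥(unitaryGroupOfForm (starRingEnd ℂ) J) => ((((u.1 : ↥(unitaryGroupOfForm (starRingEnd ℂ) J)) : GL (Fin 2) ℂ) : Matrix (Fin 2) (Fin 2) ℂ), (((u.2 : ↥(unitaryGroupOfForm (starRingEnd ℂ) J)) : GL (Fin 2) ℂ) : Matrix (Fin 2) (Fin 2) ℂ))) ''
      (Prod.fst '' (e' '' tsupport (fun m : ↥(Subgroup.centralizer ({gprimeTorus L α S p} : Set ↥(arch (↥(maximalRealSubfield L)) L (IsCMField.complexConj L) 3 (Matrix.diagonal α)))) => ∫ x, β x • a' (x * (m : ↥(arch (↥(maximalRealSubfield L)) L (IsCMField.complexConj L) 3 (Matrix.diagonal α))) * x⁻¹) ∂ν')))) :=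
    ((haMs.isCompact.image e'.continuous).image continuous_fst).image
      ((Units.continuous_val.comp (continuous_subtype_val.comp continuous_fst)).prodMk (Units.continuous_val.comp (continuous_subtype_val.comp continuous_snd)))
  obtain ⟨χ, hχd, hχc, hχ1, -⟩ := Literature.Analysis.Calculus.exists_contDiff_hasCompactSupport_eq_one_of_isCompact hS₀
  -- the double tangential spectator is smooth
  have hupd₁ : ContDiff ℝ ∞ fun c : {w : InfinitePlace L // IsComplex w} → Fin 3 → ℝ => Function.update c w₁ (![0, c w₁ 1, 0] : Fin 3 → ℝ) := by
    refine contDiff_pi.2 fun w => ?_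
    rcases eq_or_ne w w₁ with rfl | hw
    · simp only [Function.update_self]
      refine contDiff_pi.2 fun i => ?_
      fin_cases i
      · exact contDiff_const
      · exact contDiff_apply_apply ℝ ℝ w 1
      · exact contDiff_const
    · simp only [Function.update_of_ne hw]
      exact contDiff_apply ℝ (Fin 3 → ℝ) w
  have hupd₂ : ContDiff ℝ ∞ fun c : {w : InfinitePlace L // IsComplex w} → Fin 3 → ℝ => Function.update c w₂ (![0, c w₂ 1, 0] : Fin 3 → ℝ) := by
    refine contDiff_pi.2 fun w => ?_
    rcases eq_or_ne w w₂ with rfl | hw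
    · simp only [Function.update_self]
      refine contDiff_pi.2 fun i => ?_
      fin_cases i
      · exact contDiff_const
      · exact contDiff_apply_apply ℝ ℝ w 1
      · exact contDiff_const
    · simp only [Function.update_of_ne hw]
      exact contDiff_apply ℝ (Fin 3 → ℝ) w
  have hupd : ContDiff ℝ ∞ fun c : {w : InfinitePlace L // IsComplex w} → Fin 3 → ℝ => Function.update (Function.update c w₁ (![0, c w₁ 1, 0] : Fin 3 → ℝ)) w₂ (![0, c w₂ 1, 0] : Fin 3 → ℝ) := by
    have h := hupd₂.comp hupd₁
    have hfun : (fun c : {w : InfinitePlace L // IsComplex w} → Fin 3 → ℝ => Function.update (Function.update c w₁ (![0, c w₁ 1, 0] : Fin 3 → ℝ)) w₂ (![0, c w₂ 1, 0] : Fin 3 → ℝ)) =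
        (fun c : {w : InfinitePlace L // IsComplex w} → Fin 3 → ℝ => Function.update c w₂ (![0, c w₂ 1, 0] : Fin 3 → ℝ)) ∘
          (fun c : {w : InfinitePlace L // IsComplex w} → Fin 3 → ℝ => Function.update c w₁ (![0, c w₁ 1, 0] : Fin 3 → ℝ)) := by
      funext c
      simp only [Function.comp_apply, Function.update_of_ne (Ne.symm h12)]
    rw [hfun]
    exact h
  -- the double update is idempotent (the tangential clause)
  have hupd_idem : ∀ c : {w : InfinitePlace L // IsComplex w} → Fin 3 → ℝ,
      Function.update (Function.update (Function.update (Function.update c w₁ (![0, c w₁ 1, 0] : Fin 3 → ℝ)) w₂ (![0, c w₂ 1, 0] : Fin 3 → ℝ)) w₁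
          (![0, (Function.update (Function.update c w₁ (![0, c w₁ 1, 0] : Fin 3 → ℝ)) w₂ (![0, c w₂ 1, 0] : Fin 3 → ℝ)) w₁ 1, 0] : Fin 3 → ℝ)) w₂
        (![0, (Function.update (Function.update c w₁ (![0, c w₁ 1, 0] : Fin 3 → ℝ)) w₂ (![0, c w₂ 1, 0] : Fin 3 → ℝ)) w₂ 1, 0] : Fin 3 → ℝ) = Function.update (Function.update c w₁ (![0, c w₁ 1, 0] : Fin 3 → ℝ)) w₂ (![0, c w₂ 1, 0] : Fin 3 → ℝ) := by
    intro c
    funext w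
    by_cases hw2 : w = w₂
    · rw [hw2]
      simp only [Function.update_self, Matrix.cons_val_one, Matrix.cons_val_zero]
    · by_cases hw1 : w = w₁
      · rw [hw1]
        simp only [Function.update_of_ne h12, Function.update_self, Matrix.cons_val_one, Matrix.cons_val_zero]
      · simp only [Function.update_of_ne hw1, Function.update_of_ne hw2]
  have hRρ : ContDiff ℝ ∞ fun c : {w : InfinitePlace L // IsComplex w} → Fin 3 → ℝ => (((gprimeTorus L α S (Function.update (Function.update c w₁ (![0, c w₁ 1, 0] : Fin 3 → ℝ)) w₂ (![0, c w₂ 1, 0] : Fin 3 → ℝ)) : ↥(arch (↥(maximalRealSubfield L)) L (IsCMField.complexConj L) 3 (Matrix.diagonal α))) : GL (Fin 3) (mixedSpace L)) : Matrix (Fin 3) (Fin 3) (mixedSpace L)) :=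
    (contDiff_coe_gprimeTorus L α S).comp hupd
  -- the family
  obtain ⟨f, hf⟩ : ∃ f : ({w : InfinitePlace L // IsComplex w} → Fin 3 → ℝ) × (Matrix (Fin 2) (Fin 2) ℂ × Matrix (Fin 2) (Fin 2) ℂ) → ℂ, f = fun q =>
      (χ q.2 : ℂ) * ΘM (Λ₁ (((M1⁻¹ : GL (Fin 2) ℂ) : Matrix (Fin 2) (Fin 2) ℂ) * q.2.1 * ((M1 : GL (Fin 2) ℂ) : Matrix (Fin 2) (Fin 2) ℂ)) * Λ₂ (((M2⁻¹ : GL (Fin 2) ℂ) : Matrix (Fin 2) (Fin 2) ℂ) * q.2.2 * ((M2 : GL (Fin 2) ℂ) : Matrix (Fin 2) (Fin 2) ℂ)) *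
        (((gprimeTorus L α S (Function.update (Function.update q.1 w₁ (![0, q.1 w₁ 1, 0] : Fin 3 → ℝ)) w₂ (![0, q.1 w₂ 1, 0] : Fin 3 → ℝ)) : ↥(arch (↥(maximalRealSubfield L)) L (IsCMField.complexConj L) 3 (Matrix.diagonal α))) : GL (Fin 3) (mixedSpace L)) : Matrix (Fin 3) (Fin 3) (mixedSpace L))) := ⟨_, rfl⟩
  have hfs : ContDiff ℝ ∞ f := by
    rw [hf]
    refine ((Complex.ofRealCLM.contDiff.comp ((hχd ⊤).comp contDiff_snd)).mul
      (hΘM.comp ((((hΛ₁.comp ((contDiff_const.mul (contDiff_fst.comp contDiff_snd)).mul contDiff_const)).mul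
        (hΛ₂.comp ((contDiff_const.mul (contDiff_snd.comp contDiff_snd)).mul contDiff_const))).mul (hRρ.comp contDiff_fst)))))
  -- `f (c, (↑↑u₁, ↑↑u₂)) = (a′)_M^β (e′⁻¹((u₁, u₂), r))` for every `c`, `u₁`, `u₂` and every `r ∈ K` over the double tangential point
  have hfB : ∀ (c : {w : InfinitePlace L // IsComplex w} → Fin 3 → ℝ) (u₁ u₂ : ↥(unitaryGroupOfForm (starRingEnd ℂ) J)) (r : ↥K),
      (((r : ↥(Subgroup.centralizer ({gprimeTorus L α S p} : Set ↥(arch (↥(maximalRealSubfield L)) L (IsCMField.complexConj L) 3 (Matrix.diagonal α))))) : ↥(arch (↥(maximalRealSubfield L)) L (IsCMField.complexConj L) 3 (Matrix.diagonal α))) : GL (Fin 3) (mixedSpace L)) = (gprimeTorus L α S (Function.update (Function.update c w₁ (![0, c w₁ 1, 0] : Fin 3 → ℝ)) w₂ (![0, c w₂ 1, 0] : Fin 3 → ℝ)) : GL (Fin 3) (mixedSpace L)) →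
      (fun m : ↥(Subgroup.centralizer ({gprimeTorus L α S p} : Set ↥(arch (↥(maximalRealSubfield L)) L (IsCMField.complexConj L) 3 (Matrix.diagonal α)))) => ∫ x, β x • a' (x * (m : ↥(arch (↥(maximalRealSubfield L)) L (IsCMField.complexConj L) 3 (Matrix.diagonal α))) * x⁻¹) ∂ν') (e'.symm ((u₁, u₂), r)) = f (c, (((u₁ : GL (Fin 2) ℂ) : Matrix (Fin 2) (Fin 2) ℂ), ((u₂ : GL (Fin 2) ℂ) : Matrix (Fin 2) (Fin 2) ℂ))) := by
    intro c u₁ u₂ r hr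
    have haM' := congrFun haM (e'.symm ((u₁, u₂), r))
    beta_reduce at haM'
    beta_reduce
    have hread : ΘM ((((e'.symm ((u₁, u₂), r) : ↥(Subgroup.centralizer ({gprimeTorus L α S p} : Set ↥(arch (↥(maximalRealSubfield L)) L (IsCMField.complexConj L) 3 (Matrix.diagonal α))))) : ↥(arch (↥(maximalRealSubfield L)) L (IsCMField.complexConj L) 3 (Matrix.diagonal α))) : GL (Fin 3) (mixedSpace L)) : Matrix (Fin 3) (Fin 3) (mixedSpace L)) =
        ΘM (Λ₁ (((M1⁻¹ : GL (Fin 2) ℂ) : Matrix (Fin 2) (Fin 2) ℂ) * ((u₁ : GL (Fin 2) ℂ) : Matrix (Fin 2) (Fin 2) ℂ) * ((M1 : GL (Fin 2) ℂ) : Matrix (Fin 2) (Fin 2) ℂ)) * Λ₂ (((M2⁻¹ : GL (Fin 2) ℂ) : Matrix (Fin 2) (Fin 2) ℂ) * ((u₂ : GL (Fin 2) ℂ) : Matrix (Fin 2) (Fin 2) ℂ) * ((M2 : GL (Fin 2) ℂ) : Matrix (Fin 2) (Fin 2) ℂ)) *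
          (((gprimeTorus L α S (Function.update (Function.update c w₁ (![0, c w₁ 1, 0] : Fin 3 → ℝ)) w₂ (![0, c w₂ 1, 0] : Fin 3 → ℝ)) : ↥(arch (↥(maximalRealSubfield L)) L (IsCMField.complexConj L) 3 (Matrix.diagonal α))) : GL (Fin 3) (mixedSpace L)) : Matrix (Fin 3) (Fin 3) (mixedSpace L))) := by
      rw [hsymm]
      simp only [Subgroup.coe_mul, Units.val_mul]
      rw [hΛ₁b' (φ₁.symm u₁), hΛ₂b' (φ₂.symm u₂), hφsymm₁ u₁, hφsymm₂ u₂, hr]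
    by_cases hu : (e'.symm ((u₁, u₂), r)) ∈ tsupport (fun m : ↥(Subgroup.centralizer ({gprimeTorus L α S p} : Set ↥(arch (↥(maximalRealSubfield L)) L (IsCMField.complexConj L) 3 (Matrix.diagonal α)))) => ∫ x, β x • a' (x * (m : ↥(arch (↥(maximalRealSubfield L)) L (IsCMField.complexConj L) 3 (Matrix.diagonal α))) * x⁻¹) ∂ν')
    · have hχu : χ (((u₁ : GL (Fin 2) ℂ) : Matrix (Fin 2) (Fin 2) ℂ), ((u₂ : GL (Fin 2) ℂ) : Matrix (Fin 2) (Fin 2) ℂ)) = 1 :=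
        hχ1 _ ⟨(u₁, u₂), ⟨((u₁, u₂), r), ⟨_, hu, e'.apply_symm_apply _⟩, rfl⟩, rfl⟩
      rw [hf]
      beta_reduce
      rw [hχu, Complex.ofReal_one, one_mul, haM', hread]
    · have h0 := image_eq_zero_of_notMem_tsupport hu
      beta_reduce at h0
      have h0' := h0
      rw [haM', hread] at h0'
      rw [h0, hf]
      beta_reduce
      rw [h0', mul_zero]
  -- the `K`-component over the double tangential point ([6])
  have h6' : ∀ c : {w : InfinitePlace L // IsComplex w} → Fin 3 → ℝ,
      (((((e ⟨gprimeTorus L α S c, gprimeTorus_mem_centralizer L α S p c⟩).2 : ↥K) : ↥(Subgroup.centralizer ({gprimeTorus L α S p} : Set ↥(arch (↥(maximalRealSubfield L)) L (IsCMField.complexConj L) 3 (Matrix.diagonal α))))) : ↥(arch (↥(maximalRealSubfield L)) L (IsCMField.complexConj L) 3 (Matrix.diagonal α))) : GL (Fin 3) (mixedSpace L)) = (gprimeTorus L α S (Function.update (Function.update c w₁ (![0, c w₁ 1, 0] : Fin 3 → ℝ)) w₂ (![0, c w₂ 1, 0] : Fin 3 → ℝ)) : GL (Fin 3) (mixedSpace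 L)) :=
    fun c => by rw [h6 c]
  -- ### the descent constant `K = dt′(B′)·κ ≠ 0`
  have hdtS := toReal_chartHaarG_chartBoxImgG_pos L α S hα hS
  have hK0 : (((chartHaarG L α S (chartBoxImgG L α S)).toReal : ℂ) * ((κ : ℝ) : ℂ)) ≠ 0 :=
    mul_ne_zero (Complex.ofReal_ne_zero.2 hdtS.ne') (Complex.ofReal_ne_zero.2 (NNReal.coe_ne_zero.2 hκ))
  -- ### integrability at regular chart points (★ p850485)
  letI : MeasurableSpace (↥(arch (↥(maximalRealSubfield L)) L (IsCMField.complexConj L) 3 (Matrix.diagonal α)) ⧸ chartTorusG L α S) := borel _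
  haveI : BorelSpace (↥(arch (↥(maximalRealSubfield L)) L (IsCMField.complexConj L) 3 (Matrix.diagonal α)) ⧸ chartTorusG L α S) := ⟨rfl⟩
  haveI := isMulLeftInvariant_chartHaarG L α S
  haveI := isFiniteMeasureOnCompacts_chartHaarG L α S
  haveI := isOpenPosMeasure_chartHaarG L α S
  have hq : chartQuotientMeasureG L α ν' S = quotientMeasure (chartTorusG L α S) (chartHaarG L α S) (isClosed_chartTorusG L α S) ν' := rfl
  haveI : IsFiniteMeasureOnCompacts (chartQuotientMeasureG L α ν' S) := by rw [hq]; infer_instance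
  -- ### the block reading of `γ_c` through `e′` ([5]₁ [5]₂ + (B-STD) (i) at both places)
  have hγ : ∀ c : {w : InfinitePlace L // IsComplex w} → Fin 3 → ℝ,
      e' ⟨gprimeTorus L α S c, hT (gprimeTorus_mem_chartTorusG L α S c)⟩ =
        (((⟨Matrix.GeneralLinearGroup.mkOfDetNeZero !![(1 : ℂ), 1; 1, -1] det_cayleyTwo_ne_zero * circleDiagonal 2 ![Circle.exp (c w₁ 0), Circle.exp (c w₁ 2)] * (Matrix.GeneralLinearGroup.mkOfDetNeZero !![(1 : ℂ), 1; 1, -1] det_cayleyTwo_ne_zero)⁻¹, cayley_conj_circleDiagonal_mem_of_eq_over hJ _⟩ : ↥(unitaryGroupOfForm (starRingEnd ℂ) J)),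
          (⟨Matrix.GeneralLinearGroup.mkOfDetNeZero !![(1 : ℂ), 1; 1, -1] det_cayleyTwo_ne_zero * circleDiagonal 2 ![Circle.exp (c w₂ 0), Circle.exp (c w₂ 2)] * (Matrix.GeneralLinearGroup.mkOfDetNeZero !![(1 : ℂ), 1; 1, -1] det_cayleyTwo_ne_zero)⁻¹, cayley_conj_circleDiagonal_mem_of_eq_over hJ _⟩ : ↥(unitaryGroupOfForm (starRingEnd ℂ) J))),
          (e ⟨gprimeTorus L α S c, gprimeTorus_mem_centralizer L α S p c⟩).2) := by
    intro c
    have h1 : (e ⟨gprimeTorus L α S c, gprimeTorus_mem_centralizer L α S p c⟩).1.1 =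
        ⟨circleDiagonal 2 ![Circle.exp (c w₁ 0), Circle.exp (c w₁ 2)], circleDiagonal_mem_unitaryGroupOfForm_diagonal_map_weights w₁.1.embedding ![α (lineOf (formSign L α w₁) 0), α (lineOf (formSign L α w₁) 2)] _⟩ :=
      Subtype.ext (h5₁ c)
    have h2 : (e ⟨gprimeTorus L α S c, gprimeTorus_mem_centralizer L α S p c⟩).1.2 =
        ⟨circleDiagonal 2 ![Circle.exp (c w₂ 0), Circle.exp (c w₂ 2)], circleDiagonal_mem_unitaryGroupOfForm_diagonal_map_weights w₂.1.embedding ![α (lineOf (formSign L α w₂) 0), α (lineOf (formSign L α w₂) 2)] _⟩ :=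
      Subtype.ext (h5₂ c)
    rw [he', h1, h2, hφ₁, hφ₂]
  -- ### assembling
  refine ⟨(((chartHaarG L α S (chartBoxImgG L α S)).toReal : ℂ) * ((κ : ℝ) : ℂ)), U, f, hK0, hUo, hpU, hfs, ⟨tsupport χ, hχc, fun c XY hXY => ?_⟩, fun c XY => ?_, ?_⟩
  · rw [hf]; dsimp only; rw [image_eq_zero_of_notMem_tsupport hXY, Complex.ofReal_zero, zero_mul]
  · rw [hf]; dsimp only
    rw [hupd_idem c]
  rintro c ⟨hcU, hcreg⟩
  have hint := integrable_descConj_gprimeTorus_of_regG L α S hα hS hcreg ha'c ha's (chartQuotientMeasureG L α ν' S)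
  rw [chartOrbG_eq_integral_descended_of_cutoff L α ν' S a' ha'c (gprimeTorus L α S p) νM hT hβc hβs hβ0 hβ1S c hint (hCM c hcU),
    integral_descConj_eq_smul_integral_of_block _ _ e' Ψ hΨ _ (μ₀.prod μ₀) hmap _ _ _ (hγ c) _ haMc, NNReal.smul_def, Complex.real_smul, ← mul_assoc]
  congr 1
  refine integral_congr_ae (Filter.Eventually.of_forall fun b => ?_)
  exact hfB c _ _ _ (h6' c)

set_option maxHeartbeats 800000 in
/-- **(X2) IN-REGULAR EDITION, `Measure.pi` FORM** (for the `Fin m → U(J)` towers of ★ (J) `ArchCayleyTowerFubini`): the same `K`, `U`, `f` with the integral over `Fin 2 → U(J)` against `Measure.pi (fun _ => μ₀)`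
(Mathlib `measurePreserving_finTwoArrow`). [cite: Rogawski1990, §4.12 Lemma 4.12.1 p. 66; §8.2 pp. 119–124] [cite: Folland1995, §2.6 (2.52)] -/
theorem exists_descent_twoBlock_box_chartOrbG_inReg_pi (hα : ∀ i, α i ≠ 0)
    (hreal : ∀ (w : {w : InfinitePlace L // IsComplex w}) (i : Fin 3), (w.1.embedding (α i)).im = 0)
    {J : Matrix (Fin 2) (Fin 2) ℂ} (hJ : J = (StdForm.antidiagonal 2).over ℂ)
    [MeasurableSpace ↥(unitaryGroupOfForm (starRingEnd ℂ) J)] [BorelSpace ↥(unitaryGroupOfForm (starRingEnd ℂ) J)]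
    [LocallyCompactSpace ↥(unitaryGroupOfForm (starRingEnd ℂ) J)] [SecondCountableTopology ↥(unitaryGroupOfForm (starRingEnd ℂ) J)]
    (μ₀ : Measure ↥(unitaryGroupOfForm (starRingEnd ℂ) J)) [μ₀.IsHaarMeasure] [μ₀.IsMulRightInvariant]
    {S : Finset {w : InfinitePlace L // IsComplex w}} {w₁ w₂ : {w : InfinitePlace L // IsComplex w}} {x : {w : InfinitePlace L // IsComplex w} → Fin 3 → ℝ}
    (hS : ∀ w, w ∈ S → w ∈ splitChartPlaces L α) (hw₁ : w₁ ∉ S) (hw₂ : w₂ ∉ S) (h12 : w₁ ≠ w₂)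
    (hw₁sp : w₁ ∈ splitChartPlaces L α) (hw₂sp : w₂ ∈ splitChartPlaces L α)
    (h02₁ : x w₁ 0 = x w₁ 2) (h01₁ : Circle.exp (x w₁ 0) ≠ Circle.exp (x w₁ 1))
    (h02₂ : x w₂ 0 = x w₂ 2) (h01₂ : Circle.exp (x w₂ 0) ≠ Circle.exp (x w₂ 1))
    (hinreg : ∀ w, w ∉ S → w ≠ w₁ → w ≠ w₂ → ∀ i j : Fin 3, i ≠ j → slotSign L α w i ≠ slotSign L α w j → Circle.exp (x w i) ≠ Circle.exp (x w j))
    (hxS : ∀ w, w ∈ S → x w 0 ≠ 0)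
    {a' : ↥(arch (↥(maximalRealSubfield L)) L (IsCMField.complexConj L) 3 (Matrix.diagonal α)) → ℂ} (ha' : ArchSmooth L 3 (Matrix.diagonal α) a') :
    ∃ (K : ℂ) (U : Set ({w : InfinitePlace L // IsComplex w} → Fin 3 → ℝ)) (f : ({w : InfinitePlace L // IsComplex w} → Fin 3 → ℝ) × (Matrix (Fin 2) (Fin 2) ℂ × Matrix (Fin 2) (Fin 2) ℂ) → ℂ),
      K ≠ 0 ∧ IsOpen U ∧ x ∈ U ∧ ContDiff ℝ ∞ f ∧
      (∃ C : Set (Matrix (Fin 2) (Fin 2) ℂ × Matrix (Fin 2) (Fin 2) ℂ), IsCompact C ∧ ∀ c XY, XY ∉ C → f (c, XY) = 0) ∧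
      (∀ c XY, f (c, XY) = f (Function.update (Function.update c w₁ ![0, c w₁ 1, 0]) w₂ ![0, c w₂ 1, 0], XY)) ∧
      ∀ c ∈ U ∩ RegG S, chartOrbG L α ν' S a' c =
        K * ∫ h : Fin 2 → ↥(unitaryGroupOfForm (starRingEnd ℂ) J),
          f (c, ((((h 0 * (⟨Matrix.GeneralLinearGroup.mkOfDetNeZero !![(1 : ℂ), 1; 1, -1] det_cayleyTwo_ne_zero *
              circleDiagonal 2 ![Circle.exp (c w₁ 0), Circle.exp (c w₁ 2)] * (Matrix.GeneralLinearGroup.mkOfDetNeZero !![(1 : ℂ), 1; 1, -1] det_cayleyTwo_ne_zero)⁻¹,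
            cayley_conj_circleDiagonal_mem_of_eq_over hJ _⟩ : ↥(unitaryGroupOfForm (starRingEnd ℂ) J)) * (h 0)⁻¹ : ↥(unitaryGroupOfForm (starRingEnd ℂ) J)) : GL (Fin 2) ℂ) : Matrix (Fin 2) (Fin 2) ℂ),
                 (((h 1 * (⟨Matrix.GeneralLinearGroup.mkOfDetNeZero !![(1 : ℂ), 1; 1, -1] det_cayleyTwo_ne_zero *
              circleDiagonal 2 ![Circle.exp (c w₂ 0), Circle.exp (c w₂ 2)] * (Matrix.GeneralLinearGroup.mkOfDetNeZero !![(1 : ℂ), 1; 1, -1] det_cayleyTwo_ne_zero)⁻¹,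
            cayley_conj_circleDiagonal_mem_of_eq_over hJ _⟩ : ↥(unitaryGroupOfForm (starRingEnd ℂ) J)) * (h 1)⁻¹ : ↥(unitaryGroupOfForm (starRingEnd ℂ) J)) : GL (Fin 2) ℂ) : Matrix (Fin 2) (Fin 2) ℂ))) ∂(Measure.pi fun _ => μ₀) := by
  obtain ⟨K, U, f, hK, hU, hpU, hf, hC, htan, hid⟩ := exists_descent_twoBlock_box_chartOrbG_inReg L α ν' hα hreal hJ μ₀ hS hw₁ hw₂ h12 hw₁sp hw₂sp
    h02₁ h01₁ h02₂ h01₂ hinreg hxS ha'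
  refine ⟨K, U, f, hK, hU, hpU, hf, hC, htan, fun c hc => ?_⟩
  rw [hid c hc, ← (measurePreserving_finTwoArrow μ₀).integral_comp' (f := MeasurableEquiv.finTwoArrow)]
  rfl

end Chart

end Literature.NumberTheory.Rogawski1990

end
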